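import Mathlib
import HarnessLib
import HarnessLib.Audit
import Summits.MatrixMultiplication.Statement
import Literature.Computability.AlgebraicComplexity.RectangularExponentAlpha
import Summits.MatrixMultiplication.MatrixMultiplication.Theorems.SaturationLadderExpSaturation
import Summits.MatrixMultiplication.MatrixMultiplication.Theorems.SaturationLadderGradeOneThirdCert
import HarnessLib.Audit.Status.Attr

/-!
Route: LongShapeTightness

CLOSED (superseded) 2026-08-30T03:13:51Z by planner-decomp-mm-lens-1-g3-0 — reason: superseded:route-MatrixMultiplication-SaturationLadder — superseded by route-MatrixMultiplication-SaturationLadder — note: gen-0 cut S ⟺ EventualTightness ∧ LengthTransfer collapses: ET stmt-24102 ⟸ ExpSaturation stmt-25913 = theorem-candidate (critic-verified certificate, STATUS l.96); kernel collapse : ET → (LengthTransfer ↔ S) (HOME/decomp-mm-lens-1/LongShapeTightnessV2.lean); shared items 24102/24105/24106 live on a. The file is kept as the record of this route; refuted decls are indexed as negative knowledge (`ledger negatives`).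

# Route LongShapeTightness — omega=2 iff every thin shape gets tight when lengthened and tightness
is scale-free

It suffices to show X = EventualTightness ∧ LengthTransfer, and S ⟺ X (kernel `summit_iff` in the
lens draft
`pub/decomp-mm/decomp-mm-lens-1/LongShapeTightness.lean`). Grade ω(ℂ) = 2 by the TWO-parameter
family of shapes ⟨n, n^t, n^r⟩,
0 ≤ t ≤ 1 ≤ r, through T(t,r) :≡ ω(1,t,r) ≤ 1 + r (the information bound 1 + r ≤ ω(1,t,r) makes
T(t,r) ⟺ equality). T is antitone
in t and MONOTONE in r (Lotti–Romani subadditivity: lengthening the long side only helps), so for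
each t the tight lengths form an
up-set [r*(t), ∞) ∪ ∅ and S says r* ≡ 1 on [0,1). Piece A = EventualTightness: r*(t) < ∞ for every t
< 1 (every thin shape becomes
information-tight after enough lengthening). Piece B = LengthTransfer: r*(t) ∈ {1, ∞} (lengthening
never CREATES tightness: a tight
long shape is already tight at length r = 1). Decomposition-workshop node (decomp-mm gen 0, lens 1
«grading»); no idea card realised.
Lean: `(∀ t : ℝ, 0 ≤ t → t < 1 → ∃ r : ℝ, 1 ≤ r ∧
Literature.Computability.AlgebraicComplexity.omegaRect ℂ 1 t r ≤ 1 + r) ∧ (∀ t r : ℝ, 0 ≤ t → t ≤ 1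
→ 1 ≤ r → Literature.Computability.AlgebraicComplexity.omegaRect ℂ 1 t r ≤ 1 + r →
Literature.Computability.AlgebraicComplexity.omegaRect ℂ 1 t 1 ≤ 2)`

## Assembly
Pure logic plus the α-characterisation of S: given 0 ≤ t < 1, A gives a tight length r, B transfers
it to ω(1,t,1) ≤ 2, the information
bound gives ω(1,t,1) = 2, hence t ≤ α (tree `le_dualExponentAlpha_of_omegaRect_eq_two`); t < 1
arbitrary and density give α = 1, i.e.
ω = 2 (tree `dualExponentAlpha_eq_one_iff`, `MatrixMultiplication_iff`). Conversely ω = 2 gives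
ω(1,t,1) = 2 ≤ 1 + r for all t ≤ 1 ≤ r, whence
A (witness r = 1) and B (conclusion outright) — `summit_iff` in the draft. The deciding theorem
`closes` (glue.lean) consumes exactly the two
cruxes (bc6: the Assembly item is the schema record of the same implication; the graded rungs
GradeOneThird / GradeRow033 are asides).

Rationale: WHY THIS LINE. Every tightness theorem in print is independent of the long side: ⟨n, n^t, n^r⟩ is
tight for t ≤ α and all r (the cone, HuangPan1998 §7
p.282, Coppersmith1997) and nothing is known for t > α at any r; yet economies of scale in r are
real and PROVED — the deficiency
ω(1,1,r) − r − 1 decreases to 0 (perfect amortisation, Coppersmith1982 / LottiRomani1983 Prop. 4.1,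
tree `perfectAmortisation_proof`),
and by convexity from the tight corner (1,0,1) the deficiency d(t,r) := ω(1,t,r) − (1+r) tends to 0
as r → ∞ for EVERY t < 1 (kernel
`limitForm_of_perfectAmortisation` in the draft). ω = 2 is therefore cut along the boundary curve of
the tight region into "the vanishing
deficiency vanishes at a finite length" (A, a finiteness statement sitting just above a proved
limit) and "the critical middle exponent of
the tight region does not depend on the length" (B, a structural transfer statement whose lossy
version T(t,r) ⇒ T(2t/(1+r), 1) is a
theorem by symmetrisation, kernel `lengthTransfer_lossy`). Both pieces are consequences of S
(kernel), each holds in a world with ω > 2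
(A with scale-dependent tightness, B with a cone-shaped tight region and α < 1), and their
conjunction is S by three lines. Imported: the
geometry of Strassen's spectrum of shapes (LottiRomani1983 §1 convexity, HuangPan1998 §8.1) — no
outside area. Prior routes fix ONE shape
parameter: RectangularAlpha (dormant; α-ladder on r = 1), EPRFaces / LongBlockAmortisation /
ShapeSubmodularity / CubicExchangeSplit (far rungs
E_k on t = 1), FarEdgeDescent (lens 2, born today: finite saturation on t = 1 plus log-convex
descent). Here r is a RESOURCE traded against t:
A is strictly weaker than FarEdgeDescent.FiniteSaturation and than every far rung (kernel
`eventualTightness_of_far_mid`), and B is not an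
item or card anywhere (negatives index: 12 entries, none on ω(1,t,r) with r > 1).

RANKED CRUXES. #2 EventualTightness (crux) — Piece A — for every middle exponent 0 ≤ t < 1 there is
a length r ≥ 1 at which the shape ⟨n, n^t, n^r⟩ is information-tight, ω(1,t,r) ≤ 1 + r (r may depend
on t). Tag WEAKER (S ⟹ A kernel `eventualTightness_of_summit`; A pays only α ≥ 2t/(1+r), ω ≤
3(1+r)/(1+t+r), far excess ≤ 2/(1+t) — kernel `alpha_ge_of_tight`, `omega_le_of_tight`,
`far_excess_of_tight`; its limit form ∀t ∀ε ∃r ω(1,t,r) ≤ 1+r+ε is PROVED). Leaf GRADED: rungs A_t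
PROVED for t ≤ 0.1722 (kernel, Coppersmith 1982) and t ≤ 0.321334 (named fact vxxz2024_alpha_ge); t
∈ {0.33, 1/3} INSTRUMENTABLE (test T1: saturation threshold α_LB(r) of the asymmetric CW_q laser
optimisation at shapes (1,t,r), r ∈ {2,4,8,16,32}; test T2: CLLZ quantum-functional barrier at ⟨n,
n^{1/3}, n^r⟩); 0.34 ≤ t < 1 UNDECIDED-with-test; t → 1 IDEA-NEEDED. [difficulty: open-problem] (why
it might fail: ω > 2 with scale-free tightness: the deficiency d(t,r) may decay like c(t)/r without
vanishing (as every first-power CW_q bound does, d ≈ t·log2/log q); no R̃-sharp tensor family on two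
unequal legs is known beyond the cone t ≤ α.) [HuangPan1998, LottiRomani1983, Coppersmith1982,
Coppersmith1997, LeGall2012, VassilevskaWilliamsXuXuZhou2024,
AlmanDuanVassilevskaWilliamsXuXuZhou2025]
#3 LengthTransfer (crux) — Piece B — tightness is scale-free in the long side: if ⟨n, n^t, n^r⟩ is
information-tight for some r ≥ 1 then already ⟨n, n^t, n⟩ is, ω(1,t,1) = 2 (equivalently: the
critical middle exponent α_r := sup{t : T(t,r)} equals α for every r). Tag WEAKER (S ⟹ B kernel
`lengthTransfer_of_summit`; B holds if α < 1 and the tight region is exactly the cone; NOT the bare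
residual A → S: pointwise in (t,r), and the LOSSY transfer T(t,r) ⇒ T(2t/(1+r),1) is PROVED, kernel
`lengthTransfer_lossy`, loss factor 2/(1+r) — B asserts factor 1). Leaf IDEA-NEEDED (a
format-folding / de-amortisation identity beating symmetrisation); rungs B_t for t ≤ 0.321334 hold
by conclusion (kernel `lengthTransferAt_of_le_alpha`). [difficulty: open-problem] (why it might
fail: economies of scale are real (ω(1,1,r) − r strictly decreases while ω > 2), so a shape with t
slightly above α could be tight for large r only; the only transfer in print loses the factor
2/(1+r) and no de-amortisation of bilinear algorithms is known.) [HuangPan1998, LottiRomani1983,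
Coppersmith1997, LeGall2012]

TWO-LAYER PLAN. Foreseen once test T1 reports: A ⇐ a single far-or-mid rung `∃ κ ≥ 1, ω(1,κ,1) = κ +
1` (kernel `eventualTightness_of_far_mid`; stronger,
one child — filed only if T1 outcome 3 makes it attackable) or the graded rungs A_t promoted from
asides to children with the glue
`(∀ t < 1, A_t) → A` (kernel `eventualTightness_iff`). B ⇐ B_step ∧ B_closed: a uniform shortening
step T(t,r) → T(t, max 1 (r − δ)) and
closedness of the tight length set in r (continuity of the convex function r ↦ ω(1,t,r)); nothing
filed now.

KILL CRITERIA. Neither piece can be refuted without refuting ω = 2 itself (each is a kernel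
consequence of S), so no refutation closes the route short
of settling the summit negatively. What retires or reshapes it: (i) test T1 outcome 2 (saturation
threshold α_LB(r) independent of r in
every CW_q framework) ⇒ A's ladder above 0.321334 is IDEA-NEEDED and the route goes dormant until a
non-CW tensor family is proposed;
(ii) a proof of A (T1 outcome 3 or otherwise) collapses the node to the EQUIV frame S ⟺
LengthTransfer, which must then be split
(two-layer plan for B) or the route is superseded; (iii) a proof of B makes S ⟺ A and the route is
superseded by the far-rung programme
(FarEdgeDescent.FiniteSaturation ⟹ A ⟹ S).

NOT DECOMPOSED YET. The graded rungs A_t (asides GradeOneThird, GradeRow033; the parametrised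
`EventualTightnessAt t` of the draft) are not children at
open: by antitonicity no finite set of rungs closes A. The dial S ⟺ A^{(r₀)} ∧ B^{(r₀)} for a fixed
length r₀ ≥ 1 (kernel
`summit_iff_dial`; r₀ = 1 degenerates to (S, ⊤)) is stated, not filed: only the extreme settings (A:
r free; B: all r) are items.
Constants of the laser tests, the barrier value of T2, and the B_step/B_closed split are layer-2
material.

CHEAPEST FALSIFIER. Nothing falsifies A or B outright (consequences of S). The cheapest INFORMATIVE
check is test T1 at one point: run the ADVXXZ/VXXZ asymmetric
CW_q^{⊗4} optimiser (or Le Gall's F_q⊗F_q program) at the shape (1, 0.34, 4) and ask whether the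
bound saturates at exactly 5 = 1 + r
(census menu W1 prices such runs at 40–120 core-h; kit budget 0 this generation, so not run). Done
by hand (file header): the first-power
cw_q bound (Huang–Pan (7.3)) NEVER saturates for t > 0 — deficiency ≈ (t·log 2 + o(1))/log q at the
optimal q ≈ 2(1+t+r)/t, e.g.
d(0.3, r) ≤ 0.076 / 0.058 / 0.044 at r = 1 / 4 / 16 — so the long side helps but exactness needs at
least second tensor powers, exactly as
for α > 0 at r = 1 (LeGall2012 §1).

NUMBERS. α(ℂ) > 0.1722 kernel (Coppersmith1982, tree `coppersmith1982_dualExponentAlpha_gt`); α ≥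
0.321334 (VassilevskaWilliamsXuXuZhou2024, named
fact `vxxz2024_alpha_ge`); ω(1,0.33,1) ≤ 2.000092, ω(1,0.34,1) ≤ 2.000520
(AlmanDuanVassilevskaWilliamsXuXuZhou2025 Table 1); ω(1,1,2) ≤ 3.250035,
ω(1,1,3) ≤ 4.198809 (VXXZ 2024 Table 1); CW_q degeneration barrier α ≤ 0.625
(ChristandlLeGallLysikovZuiddam2025, tree
`CLLZ2025_alpha_barrier_CW`, PROVED `_holds`); inf_r (ω(1,1,r) − r) = 1 PROVED (tree
`perfectAmortisation_proof`); a tight (t,r) certifies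
α ≥ 2t/(1+r) only, which is ≤ 0.625 for every t ≤ 1 once r ≥ 2.2.

DEFINITION REQUESTS. None: every statement is over
`Literature.Computability.AlgebraicComplexity.omegaRect` / `omega` / `dualExponentAlpha`.

Novelty: Searches (2026-08-30): lit search --hybrid "rectangular matrix multiplication exponent equals
trivial lower bound k+1 long shapes tight" (8 docs: Landsberg 2017, BCS 1997 ch.15, Alman–VW 2020 —
definitions/applications only); lit vsearch "shapes … exponent equals the information lower bound;
does lengthening one side make the bound tight" (8 docs, none on point); corpus reads HuangPan1998
pp.279–282 [corpus:paper:doi-10-1006-jcom-1998-0476 p.24,p.26], ChristandlLeGallLysikovZuiddam2020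
§1.3 [corpus:paper:arxiv-2003.03019 p.3], LeGall2012 §1 [corpus:paper:arxiv-1204.1111 p.4–5], VXXZ
2024 §1, BCS §15; lit galaxy search "ω(1,1,k)|dual exponent of matrix multiplication" --star all (0
relevant) and "exponent of rectangular matrix multiplication|rectangular matrix multiplication
exponent" --star all (7 pdf hits, all algorithmic applications: arXiv:1605.08107, arXiv:2004.08777,
Yuster; 0 on tight shapes); tree: rg over Theses/ and the 185 SoloInformed Theorems (no statement on
ω(1,t,r) with t < 1 < r; TwoSidedLadder / LadderSqueeze are one-parameter).
Nearest prior art found: HuangPan1998 §7 (cone criterion t ≤ α ⇒ ω(t,1,r) = r+1, p.282) and §8.1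
(economies of scale on (1,1,r)); in the tree, route FarEdgeDescent (FiniteSaturation = a tight shape
on the line t = 1) and RectangularAlpha (α-ladder on r = 1).
Delta: nobody has used the long side r as a resource for EXACT tightness at middle exponents t > α,
nor isolated scale-freeness of tightness (α_r = α) as a statement; this route s  [refs: 1605.08107, 2004.08777, paper:doi-10-1006-jcom-1998-0476, paper:arxiv-2003.03019, paper:arxiv-1204.1111, HuangPan1998, ChristandlLeGallLysikovZuiddam2020, LeGall2012]

Barriers (technique_class: rectangular-exponents, spectrum-geometry, grading): - technique_class: rectangular-exponents, spectrum-geometry, grading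
- Literature.Barriers.MatrixMultiplication.RectangularBarrier: the α-side table
(CLLZ2025_alpha_barrier_CW, PROVED `_holds`: α-certificates via CW_q degeneration ≤ 0.625)
constrains which (t,r) a CW_q method can certify, not the cruxes — a CW_q certificate of T(t,r) is a
certificate of α ≥ 2t/(1+r), barred only when 2t/(1+r) > 0.625, so every rung with r ≥ 2.2 lies
OUTSIDE its reach; the ω̂-side table (CLLZ2025_omegaTwo_barrier_CW) bars ω = 2 and the far rungs
ω(1,1,κ) = κ+1 via CW_q, while A is strictly weaker than every far rung and its rungs with t < 1 are
not tabulated (test T2 computes them; "it may bite; the bet is that the barrier value at (1,t,r)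
drops to 1+r for large r exactly as the deficiency of the upper bounds does"); B is a transfer
statement the barrier does not quantify over.
- Literature.Barriers.MatrixMultiplication.IrreversibilityBarrier: bars ω = 2 (and, in the
universal-method form, ω < 2.16805) from powers of a fixed irreversible tensor such as CW_q; a tight
long shape yields only ω ≤ 3(1+r)/(1+t+r) ≥ 2.25 for r ≥ 2, so rungs of A via CW_q are not in
conflict with it; closing A for t → 1 or B through a fixed irreversible tensor WOULD meet it head-on
— the line does not propose that (leaf IDEA-NEEDED names a non-CW family or a format-folding
identity).
- Literature.Barriers.MatrixMultiplication.InfimumNotMinimumBarrier: both cruxes are statements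
about the infima omegaRect, never about

History (route lifecycle, newest last):
- 2026-08-30T03:13:51Z · CLOSED superseded — superseded:route-MatrixMultiplication-SaturationLadder (planner-decomp-mm-lens-1-g3-0)

sub-problem: MatrixMultiplication · status: closed(superseded) · opened planner-decomp-mm-lens-1-g0-0 2026-08-30T01:39:17Z · rev 0 · ledger route-MatrixMultiplication-LongShapeTightness
GENERATED by the gate from the ledger (D-0016/17). Provers cite these decls: `theorem foo : Summit.MatrixMultiplication.MatrixMultiplication.Theses.LongShapeTightness.<Decl> := …` in Summits/MatrixMultiplication/MatrixMultiplication/Theorems/<Name>.lean.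
-/

namespace Summit.MatrixMultiplication.MatrixMultiplication.Theses.LongShapeTightness

open scoped BigOperators Topology Manifold Classical MeasureTheory ProbabilityTheory Matrix InnerProductSpace ComplexConjugate ContinuousMap
open Filter Set Function TopologicalSpace MeasureTheory

attribute [summit_statement] _root_.MatrixMultiplication

/-- item stmt-MatrixMultiplication-24102 · crux · rank 2 · closed · proved by Summit.MatrixMultiplication.MatrixMultiplication.Theorems.SaturationLadderExpSaturation.eventualTightness_holds (prover) · by planner
why it might fail: ω > 2 with scale-free tightness: the deficiency d(t,r) may decay like c(t)/r without vanishing (as every first-power CW_q bound does, d ≈ t·log2/log q); no R̃-sharp tensor family on two unequal legs is known beyond the cone t ≤ α.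
sources: HuangPan1998, LottiRomani1983, Coppersmith1982, Coppersmith1997, LeGall2012, VassilevskaWilliamsXuXuZhou2024
[crux] Piece A — for every middle exponent 0 ≤ t < 1 there is a length r ≥ 1 at which the shape ⟨n,
n^t, n^r⟩ is information-tight, ω(1,t,r) ≤ 1 + r (r may depend on t). Tag WEAKER (S ⟹ A kernel
`eventualTightness_of_summit`; A pays only α ≥ 2t/(1+r), ω ≤ 3(1+r)/(1+t+r), far excess ≤ 2/(1+t) —
kernel `alpha_ge_of_tight`, `omega_le_of_tight`, `far_excess_of_tight`; its limit form ∀t ∀ε ∃r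
ω(1,t,r) ≤ 1+r+ε is PROVED). Leaf GRADED: rungs A_t PROVED for t ≤ 0.1722 (kernel, Coppersmith 1982)
and t ≤ 0.321334 (named fact vxxz2024_alpha_ge); t ∈ {0.33, 1/3} INSTRUMENTABLE (test T1: saturation
threshold α_LB(r) of the asymmetric CW_q laser optimisation at shapes (1,t,r), r ∈ {2,4,8,16,32};
test T2: CLLZ quantum-functional barrier at ⟨n, n^{1/3}, n^r⟩); 0.34 ≤ t < 1 UNDECIDED-with-test; t
→ 1 IDEA-NEEDED. [difficulty: open-problem] -/
@[route_item "route-MatrixMultiplication-LongShapeTightness", crux]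
def EventualTightness : Prop :=
  ∀ t : ℝ, 0 ≤ t → t < 1 → ∃ r : ℝ, 1 ≤ r ∧ Literature.Computability.AlgebraicComplexity.omegaRect ℂ 1 t r ≤ 1 + r

/-- `EventualTightness` holds: proved by `Summit.MatrixMultiplication.MatrixMultiplication.Theorems.SaturationLadderExpSaturation.eventualTightness_holds`. -/
theorem EventualTightness_holds : EventualTightness := _root_.Summit.MatrixMultiplication.MatrixMultiplication.Theorems.SaturationLadderExpSaturation.eventualTightness_holds

/-- item stmt-MatrixMultiplication-24103 · crux · rank 3 · closed · moot by None · by planner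
why it might fail: economies of scale are real (ω(1,1,r) − r strictly decreases while ω > 2), so a shape with t slightly above α could be tight for large r only; the only transfer in print loses the factor 2/(1+r) and no de-amortisation of bilinear algorithms is known.
sources: HuangPan1998, LottiRomani1983, Coppersmith1997, LeGall2012
[crux] Piece B — tightness is scale-free in the long side: if ⟨n, n^t, n^r⟩ is information-tight for
some r ≥ 1 then already ⟨n, n^t, n⟩ is, ω(1,t,1) = 2 (equivalently: the critical middle exponent α_r
:= sup{t : T(t,r)} equals α for every r). Tag WEAKER (S ⟹ B kernel `lengthTransfer_of_summit`; B
holds if α < 1 and the tight region is exactly the cone; NOT the bare residual A → S: pointwise in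
(t,r), and the LOSSY transfer T(t,r) ⇒ T(2t/(1+r),1) is PROVED, kernel `lengthTransfer_lossy`, loss
factor 2/(1+r) — B asserts factor 1). Leaf IDEA-NEEDED (a format-folding / de-amortisation identity
beating symmetrisation); rungs B_t for t ≤ 0.321334 hold by conclusion (kernel
`lengthTransferAt_of_le_alpha`). [difficulty: open-problem] -/
@[route_item "route-MatrixMultiplication-LongShapeTightness", crux]
def LengthTransfer : Prop :=
  ∀ t r : ℝ, 0 ≤ t → t ≤ 1 → 1 ≤ r → Literature.Computability.AlgebraicComplexity.omegaRect ℂ 1 t r ≤ 1 + r → Literature.Computability.AlgebraicComplexity.omegaRect ℂ 1 t 1 ≤ 2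

/-- item stmt-MatrixMultiplication-24105 · aside · rank 9 · closed · proved by Summit.MatrixMultiplication.MatrixMultiplication.Theorems.SaturationLadderGradeOneThirdCert.gradeOneThird_holds (prover) · by planner
sources: VassilevskaWilliamsXuXuZhou2024, AlmanDuanVassilevskaWilliamsXuXuZhou2025, LeGall2012
[aside] graded rung A_{1/3} of EventualTightness: some shape ⟨n, n^{1/3}, n^r⟩ is information-tight.
Strictly below RectangularAlpha.DAlphaOneThird / census row W1 (kernel gradeOneThird_of_mid);
INSTRUMENTABLE by test T1 (laser saturation threshold α_LB(r), r ∈ {2,4,8,16,32}) and T2 (CLLZ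
barrier value at the shape). Banked context, never staffed. -/
@[route_item "route-MatrixMultiplication-LongShapeTightness"]
def GradeOneThird : Prop :=
  ∃ r : ℝ, 1 ≤ r ∧ Literature.Computability.AlgebraicComplexity.omegaRect ℂ 1 (1 / 3) r ≤ 1 + r

/-- `GradeOneThird` holds: proved by `Summit.MatrixMultiplication.MatrixMultiplication.Theorems.SaturationLadderGradeOneThirdCert.gradeOneThird_holds`. -/
theorem GradeOneThird_holds : GradeOneThird := _root_.Summit.MatrixMultiplication.MatrixMultiplication.Theorems.SaturationLadderGradeOneThirdCert.gradeOneThird_holds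

/-- item stmt-MatrixMultiplication-24106 · aside · rank 9 · closed · proved by Summit.MatrixMultiplication.MatrixMultiplication.Theorems.SaturationLadderGradeOneThirdCert.gradeRow033_holds (prover) · by planner
sources: AlmanDuanVassilevskaWilliamsXuXuZhou2025
[aside] graded rung A_{0.33} of EventualTightness (first printed row above the α-record: ω(1,0.33,1)
≤ 2.000092, ADVXXZ 2025 Table 1); implied by GradeOneThird (kernel gradeRow033_of_gradeOneThird);
INSTRUMENTABLE by test T1. Banked context, never staffed. -/
@[route_item "route-MatrixMultiplication-LongShapeTightness"]
def GradeRow033 : Prop :=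
  ∃ r : ℝ, 1 ≤ r ∧ Literature.Computability.AlgebraicComplexity.omegaRect ℂ 1 0.33 r ≤ 1 + r

/-- `GradeRow033` holds: proved by `Summit.MatrixMultiplication.MatrixMultiplication.Theorems.SaturationLadderGradeOneThirdCert.gradeRow033_holds`. -/
theorem GradeRow033_holds : GradeRow033 := _root_.Summit.MatrixMultiplication.MatrixMultiplication.Theorems.SaturationLadderGradeOneThirdCert.gradeRow033_holds

/-- item stmt-MatrixMultiplication-24104 · assembly · rank 1 · closed · moot by None · by planner
sources: HuangPan1998, LottiRomani1983
[assembly] EventualTightness → LengthTransfer → ω(ℂ) = 2. -/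
@[route_item "route-MatrixMultiplication-LongShapeTightness"]
def Assembly : Prop :=
  EventualTightness → LengthTransfer → _root_.MatrixMultiplication

/-! D-0027 §2.1 — DECIDING THEOREM (planner-authored via `route open/edit --closes-file`; by planner-decomp-mm-lens-1-g0-0 2026-08-30T01:39:18Z) — ARCHIVED: route closed (superseded) 2026-08-30T03:13:51Z; kept so importers keep building:
its hypotheses are this route's items and its conclusion the sub-problem Statement (glue_lint), and it elaborates with this file. -/

@[closes "route-MatrixMultiplication-LongShapeTightness"] theorem closes (hA : EventualTightness) (hB : LengthTransfer) : _root_.MatrixMultiplication := by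
  rw [_root_.MatrixMultiplication_iff,
    ← Literature.Computability.AlgebraicComplexity.dualExponentAlpha_eq_one_iff ℂ]
  refine le_antisymm (Literature.Computability.AlgebraicComplexity.dualExponentAlpha_le_one ℂ)
    (le_of_forall_lt_imp_le_of_dense fun t ht => ?_)
  rcases lt_or_ge t 0 with ht0 | ht0
  · exact ht0.le.trans (Literature.Computability.AlgebraicComplexity.dualExponentAlpha_nonneg ℂ)
  · obtain ⟨r, hr, hT⟩ := hA t ht0 ht
    exact Literature.Computability.AlgebraicComplexity.le_dualExponentAlpha_of_omegaRect_eq_two ℂ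
      (le_antisymm (hB t r ht0 ht.le hr hT)
        (Literature.Computability.AlgebraicComplexity.two_le_omegaRect_one_mid_one ℂ t))

end Summit.MatrixMultiplication.MatrixMultiplication.Theses.LongShapeTightness
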